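import Summits.CriticalPhenomena.PercolationContinuityZ3.Theses.PercBurnResprinkle
import Summits.CriticalPhenomena.PercolationContinuityZ3.Theorems.PercBurnResprinkleVacantSetPercolatesPlaneProduct
import Summits.CriticalPhenomena.PercolationContinuityZ3.Theorems.PercBurnResprinkleVacantSetPercolatesBlockLocality
import Summits.CriticalPhenomena.PercolationContinuityZ3.Theorems.PercBurnResprinkleVacantSetPercolatesBlockMarginals
import Summits.CriticalPhenomena.PercolationContinuityZ3.Theorems.PercBurnResprinkleVacantSetPercolatesBlocksPercolate
import Summits.CriticalPhenomena.PercolationContinuityZ3.Theorems.PercBurnResprinkleVacantSetPercolatesBlocksToVacant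
import Summits.CriticalPhenomena.PercolationContinuityZ3.Theorems.PercBurnResprinkleVacantSetPercolates
import Literature.Probability.Percolation.FiniteClustersPercolationOneArm
import Literature.Probability.Percolation.SiteMonotonicity
import HarnessLib

/-!
# Crux `PercBurnResprinkle.VacantSetPercolates` (stmt-CriticalPhenomena-7205), line `sheet-plane-product`:
# the crux REDUCED TO TWO FINITE-VOLUME INPUTS AT `p_c(ℤ³)`

Lead prover-line-stmt-CriticalPhenomena-7205-c1-0, 2026-08-16.  Composes the five landed stubs of the line
(`stub_planeProduct`: the codimension-one plane-product lever `P_p(sheet) ≤ P_p(planar armed ∗-crossing)^k`, `k (2R+2) ≤ n`;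
`stub_blockLocality`, `stub_blockMarginals`, `stub_blocksPercolate`, `stub_blocksToVacant`: a `p`-agnostic one-scale static
renormalisation of the `R`-quiet set of `ℤ³` — good block = cube `[0,n]³` crossed by quiet lattice paths in the three directions and
no two quiet giants in the tripled cube; coarse PLANE of blocks; `5`-dependent bond percolation on `ℤ²`
(`DuminilCopinSidoraviciusTassion2016_dependentPercolation_holds`, PROVED); gluing BY LOCAL UNIQUENESS; lift to GHK's graph
`X = ℤ³[{y : C(y) finite}]`) with continuity in `p` of two local probabilities and `p_c(ℤ³) < 1`:
* `SPPComposition.renormalisation` — the finite-size criterion for `X`-percolation at ANY parameter `p`: for a universal `q > 0`, at every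
  scale `n ≥ 2R+2`, `P_p(sheet event) ≤ q` and `P_p(two vacant giants) ≤ q` give `P_p(0 percolates in X) > 0`;
* `SPPComposition.exists_supercritical_of_lt` — strict bounds at `p_c` persist at some `p > p_c` (polynomials in `p`);
* `vacantSetPercolates_of_sheetPlaneProductInputs` — the route decl `VacantSetPercolates` from the two registered OPEN stubs of the line,
  verbatim: (a) `stub_planarNonDegeneracy` (`P_{p_c}(planar armed ∗-crossing of the n-square at range R)^{⌊n/(2R+2)⌋} → 0` for all
  `R ≥ R₀`) and (b) `stub_localUniqueness` (`P_{p_c}(two vacant giants in [-n,2n]³ at range R) → 0` for all `R ≥ R₁`);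
* `planarNonDegeneracy_of_oneRange` — the cleaner SUFFICIENT form of (a): an RSW-type bound at ONE range,
  `∃ R₀ ≥ 1, ∃ c > 0, ∀ᶠ n, P_{p_c}(armed ∗-crossing at range R₀) ≤ 1 - c` (antitonicity in `R`, `(1-c)^m → 0`), and
  `vacantSetPercolates_of_oneRange_of_localUniqueness` — the crux from that form and (b).
So on this line the crux is CLOSED MODULO (a) and (b) (finite volume, one parameter at the symbol `p_c`; MC-true: kit j012544 E3a/E3b).
No one-arm bound, no sprinkling, no `p ↓ p_c` limit is used (Disproof §7 does not bite); dimension enters through the codimension count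
`⌊n/(2R+2)⌋` (void in `d = 2`, Disproof §8).  No definitions (events written out; pure proofs).
-/

noncomputable section

namespace Summit.CriticalPhenomena.PercolationContinuityZ3.Theorems

open MeasureTheory Set Filter
open scoped Topology
open Literature.Probability.Percolation Literature.Probability.LatticeModels

namespace SPPComposition

/-- The sheet event is the complement of the direction-`0` crossing event of the origin block (the block base point
`planeEmb 3 (n • 0)` is the origin). [folklore] -/
theorem sheet_eq_compl (n R : ℕ) :
    {ω : BondConfig (Site 3) | ¬ ∃ x y : Site 3, x 0 = 0 ∧ y 0 = (n : ℤ) ∧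
          PathIn (zdGraph 3) (quietSet R ω ∩ {x : Site 3 | ∀ i, 0 ≤ x i ∧ x i ≤ (n : ℤ)}) x y} =
      {ω : BondConfig (Site 3) | ∃ x y : Site 3, x 0 = (planeEmb 3 ((n : ℤ) • (0 : Site 2))) 0 ∧
          y 0 = (planeEmb 3 ((n : ℤ) • (0 : Site 2))) 0 + (n : ℤ) ∧
          PathIn (zdGraph 3) (quietSet R ω ∩ {x : Site 3 | ∀ i, (planeEmb 3 ((n : ℤ) • (0 : Site 2))) i ≤ x i ∧
            x i ≤ (planeEmb 3 ((n : ℤ) • (0 : Site 2))) i + (n : ℤ)}) x y}ᶜ := by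
  ext ω
  simp only [smul_zero, map_zero, Pi.zero_apply, zero_add, mem_setOf_eq, mem_compl_iff]

/-- The two-vacant-giants event of the tripled cube `[-n,2n]³` is the two-giants event of the origin block. [folklore] -/
theorem twoGiants_eq (n R : ℕ) :
    {ω : BondConfig (Site 3) | ∃ x y : Site 3,
          (∃ z : Site 3, PathIn (zdGraph 3) (quietSet R ω ∩ {x : Site 3 | ∀ i, -(n : ℤ) ≤ x i ∧ x i ≤ 2 * (n : ℤ)}) x z ∧
            ∃ i : Fin 3, (n : ℤ) ≤ |z i - x i|) ∧
          (∃ z : Site 3, PathIn (zdGraph 3) (quietSet R ω ∩ {x : Site 3 | ∀ i, -(n : ℤ) ≤ x i ∧ x i ≤ 2 * (n : ℤ)}) y z ∧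
            ∃ i : Fin 3, (n : ℤ) ≤ |z i - y i|) ∧
          ¬ PathIn (zdGraph 3) (quietSet R ω ∩ {x : Site 3 | ∀ i, -(n : ℤ) ≤ x i ∧ x i ≤ 2 * (n : ℤ)}) x y} =
      {ω : BondConfig (Site 3) | ∃ x y : Site 3,
          (∃ z : Site 3, PathIn (zdGraph 3) (quietSet R ω ∩ {x : Site 3 | ∀ i, (planeEmb 3 ((n : ℤ) • (0 : Site 2))) i - (n : ℤ) ≤ x i ∧
            x i ≤ (planeEmb 3 ((n : ℤ) • (0 : Site 2))) i + 2 * (n : ℤ)}) x z ∧ ∃ i : Fin 3, (n : ℤ) ≤ |z i - x i|) ∧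
          (∃ z : Site 3, PathIn (zdGraph 3) (quietSet R ω ∩ {x : Site 3 | ∀ i, (planeEmb 3 ((n : ℤ) • (0 : Site 2))) i - (n : ℤ) ≤ x i ∧
            x i ≤ (planeEmb 3 ((n : ℤ) • (0 : Site 2))) i + 2 * (n : ℤ)}) y z ∧ ∃ i : Fin 3, (n : ℤ) ≤ |z i - y i|) ∧
          ¬ PathIn (zdGraph 3) (quietSet R ω ∩ {x : Site 3 | ∀ i, (planeEmb 3 ((n : ℤ) • (0 : Site 2))) i - (n : ℤ) ≤ x i ∧
            x i ≤ (planeEmb 3 ((n : ℤ) • (0 : Site 2))) i + 2 * (n : ℤ)}) x y} := by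
  ext ω
  simp only [smul_zero, map_zero, Pi.zero_apply, zero_sub, zero_add, mem_setOf_eq]

/-- Continuity of `p ↦ P_p(sheet event)`: by `stub_blockLocality` the event is determined by the finite origin footprint, so its
probability is a polynomial in `p` (`continuous_bondPercolation_real_of_determinedBy`). [cite: GrimmettHolroydKozma2014, §4] -/
theorem continuous_real_sheet (n R : ℕ) :
    Continuous fun p : unitInterval => (bondPercolation (zdGraph 3) p).real
      {ω : BondConfig (Site 3) | ¬ ∃ x y : Site 3, x 0 = 0 ∧ y 0 = (n : ℤ) ∧
          PathIn (zdGraph 3) (quietSet R ω ∩ {x : Site 3 | ∀ i, 0 ≤ x i ∧ x i ≤ (n : ℤ)}) x y} := by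
  obtain ⟨hcross, -, hfin⟩ := stub_blockLocality.1 n R 0
  rw [sheet_eq_compl]
  refine continuous_bondPercolation_real_of_determinedBy (zdGraph 3) (F := hfin.toFinset) ?_
  rw [Set.Finite.coe_toFinset]
  exact (hcross 0).compl

/-- Continuity of `p ↦ P_p(two vacant giants)`, likewise from `stub_blockLocality`. [cite: GrimmettHolroydKozma2014, §4] -/
theorem continuous_real_twoGiants (n R : ℕ) :
    Continuous fun p : unitInterval => (bondPercolation (zdGraph 3) p).real
      {ω : BondConfig (Site 3) | ∃ x y : Site 3,
          (∃ z : Site 3, PathIn (zdGraph 3) (quietSet R ω ∩ {x : Site 3 | ∀ i, -(n : ℤ) ≤ x i ∧ x i ≤ 2 * (n : ℤ)}) x z ∧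
            ∃ i : Fin 3, (n : ℤ) ≤ |z i - x i|) ∧
          (∃ z : Site 3, PathIn (zdGraph 3) (quietSet R ω ∩ {x : Site 3 | ∀ i, -(n : ℤ) ≤ x i ∧ x i ≤ 2 * (n : ℤ)}) y z ∧
            ∃ i : Fin 3, (n : ℤ) ≤ |z i - y i|) ∧
          ¬ PathIn (zdGraph 3) (quietSet R ω ∩ {x : Site 3 | ∀ i, -(n : ℤ) ≤ x i ∧ x i ≤ 2 * (n : ℤ)}) x y} := by
  obtain ⟨-, htg, hfin⟩ := stub_blockLocality.1 n R 0
  rw [twoGiants_eq]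
  refine continuous_bondPercolation_real_of_determinedBy (zdGraph 3) (F := hfin.toFinset) ?_
  rw [Set.Finite.coe_toFinset]
  exact htg

/-- **Continuity step** (the planner's `stub_continuity`): strict bounds at `p_c` on the two block probabilities persist at some
`p ∈ (p_c, 1]` — two polynomials in `p`, and `p_c(ℤ³) < 1`.  This produces the crux's load-bearing conjunct `p_c < p`.
[cite: GrimmettHolroydKozma2014, §4 (proof of Thm. 5, "by the continuity in p")] -/
theorem exists_supercritical_of_lt (n R : ℕ) (q : ℝ)
    (hs : (bondPercolation (zdGraph 3) (criticalProbI 3)).real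
      {ω : BondConfig (Site 3) | ¬ ∃ x y : Site 3, x 0 = 0 ∧ y 0 = (n : ℤ) ∧
          PathIn (zdGraph 3) (quietSet R ω ∩ {x : Site 3 | ∀ i, 0 ≤ x i ∧ x i ≤ (n : ℤ)}) x y} < q)
    (hg : (bondPercolation (zdGraph 3) (criticalProbI 3)).real
      {ω : BondConfig (Site 3) | ∃ x y : Site 3,
          (∃ z : Site 3, PathIn (zdGraph 3) (quietSet R ω ∩ {x : Site 3 | ∀ i, -(n : ℤ) ≤ x i ∧ x i ≤ 2 * (n : ℤ)}) x z ∧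
            ∃ i : Fin 3, (n : ℤ) ≤ |z i - x i|) ∧
          (∃ z : Site 3, PathIn (zdGraph 3) (quietSet R ω ∩ {x : Site 3 | ∀ i, -(n : ℤ) ≤ x i ∧ x i ≤ 2 * (n : ℤ)}) y z ∧
            ∃ i : Fin 3, (n : ℤ) ≤ |z i - y i|) ∧
          ¬ PathIn (zdGraph 3) (quietSet R ω ∩ {x : Site 3 | ∀ i, -(n : ℤ) ≤ x i ∧ x i ≤ 2 * (n : ℤ)}) x y} < q) :
    ∃ p : unitInterval, criticalProb (zdGraph 3) (0 : Site 3) < (p : ℝ) ∧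
      (bondPercolation (zdGraph 3) p).real
        {ω : BondConfig (Site 3) | ¬ ∃ x y : Site 3, x 0 = 0 ∧ y 0 = (n : ℤ) ∧
          PathIn (zdGraph 3) (quietSet R ω ∩ {x : Site 3 | ∀ i, 0 ≤ x i ∧ x i ≤ (n : ℤ)}) x y} ≤ q ∧
      (bondPercolation (zdGraph 3) p).real
        {ω : BondConfig (Site 3) | ∃ x y : Site 3,
          (∃ z : Site 3, PathIn (zdGraph 3) (quietSet R ω ∩ {x : Site 3 | ∀ i, -(n : ℤ) ≤ x i ∧ x i ≤ 2 * (n : ℤ)}) x z ∧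
            ∃ i : Fin 3, (n : ℤ) ≤ |z i - x i|) ∧
          (∃ z : Site 3, PathIn (zdGraph 3) (quietSet R ω ∩ {x : Site 3 | ∀ i, -(n : ℤ) ≤ x i ∧ x i ≤ 2 * (n : ℤ)}) y z ∧
            ∃ i : Fin 3, (n : ℤ) ≤ |z i - y i|) ∧
          ¬ PathIn (zdGraph 3) (quietSet R ω ∩ {x : Site 3 | ∀ i, -(n : ℤ) ≤ x i ∧ x i ≤ 2 * (n : ℤ)}) x y} ≤ q := by
  have hev := (Filter.Tendsto.eventually_lt_const hs (continuous_real_sheet n R).continuousAt).and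
    (Filter.Tendsto.eventually_lt_const hg (continuous_real_twoGiants n R).continuousAt)
  obtain ⟨δ, hδ, hball⟩ := Metric.eventually_nhds_iff.1 hev
  have hpc1 : criticalProb (zdGraph 3) 0 < 1 := criticalProb_zd_lt_one (by norm_num)
  have hpc0 : 0 ≤ criticalProb (zdGraph 3) 0 := (criticalProb_mem_Icc (zdGraph 3) 0).1
  set r : ℝ := min 1 (criticalProb (zdGraph 3) 0 + δ / 2) with hr
  have hr0 : 0 ≤ r := le_min zero_le_one (by linarith)
  have hr1 : r ≤ 1 := min_le_left _ _
  have hrc : criticalProb (zdGraph 3) 0 < r := lt_min hpc1 (by linarith)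
  have hdist : dist (⟨r, hr0, hr1⟩ : unitInterval) (criticalProbI 3) < δ := by
    rw [Subtype.dist_eq, Real.dist_eq, coe_criticalProbI, abs_lt]
    constructor
    · linarith
    · linarith [min_le_right 1 (criticalProb (zdGraph 3) 0 + δ / 2)]
  obtain ⟨h1, h2⟩ := hball hdist
  exact ⟨⟨r, hr0, hr1⟩, hrc, h1.le, h2.le⟩

/-- From "some vertex percolates in `X`" to "the origin percolates in `X`": countable union bound and translation invariance
(`real_finiteClustersPercolateAt_eq_zero`). [folklore] -/
theorem real_finiteClustersPercolateAt_pos (p : unitInterval)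
    (h : 0 < (bondPercolation (zdGraph 3) p).real (finiteClustersPercolate (zdGraph 3))) :
    0 < (bondPercolation (zdGraph 3) p).real (finiteClustersPercolateAt 3 0) := by
  by_contra h0
  push Not at h0
  have h0' : (bondPercolation (zdGraph 3) p).real (finiteClustersPercolateAt 3 0) = 0 :=
    le_antisymm h0 measureReal_nonneg
  have hx : ∀ x : Site 3, bondPercolation (zdGraph 3) p (finiteClustersPercolateAt 3 x) = 0 := by
    intro x
    have hxr : (bondPercolation (zdGraph 3) p).real (finiteClustersPercolateAt 3 x) = 0 := by
      rw [real_finiteClustersPercolateAt_eq_zero p x, h0']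
    exact (measureReal_eq_zero_iff (measure_ne_top _ _)).1 hxr
  have hU : bondPercolation (zdGraph 3) p (finiteClustersPercolate (zdGraph 3)) = 0 := by
    rw [finiteClustersPercolate_eq_iUnion]
    exact measure_iUnion_null hx
  have : (bondPercolation (zdGraph 3) p).real (finiteClustersPercolate (zdGraph 3)) = 0 := by
    simp [measureReal_def, hU]
  linarith

/-- **Renormalisation step** (the planner's `stub_renormalisation`): with the universal `q` of `stub_blocksPercolate` (abstract
one-scale renormalisation, instantiated with the block events through `blocksPercolate_concrete`, fed `stub_blockLocality` and
`stub_blockMarginals`), at EVERY `p` and every scale `n ≥ 2R+2`, small sheet and two-giants probabilities put the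
origin in an infinite component of `X` with positive probability (coarse percolation; gluing by `stub_blocksToVacant` on the
full-measure set `{ω ⊆ E(ℤ³)}`, `DCT16.real_mono_of_forall_subset_edgeSet`; union bound + translation invariance).
[cite: GrimmettHolroydKozma2014, §4 (proof of Thm. 5, block argument)] -/
theorem renormalisation :
    ∃ q : ℝ, 0 < q ∧ ∀ (p : unitInterval) (n R : ℕ), 2 * R + 2 ≤ n →
      (bondPercolation (zdGraph 3) p).real
        {ω : BondConfig (Site 3) | ¬ ∃ x y : Site 3, x 0 = 0 ∧ y 0 = (n : ℤ) ∧
          PathIn (zdGraph 3) (quietSet R ω ∩ {x : Site 3 | ∀ i, 0 ≤ x i ∧ x i ≤ (n : ℤ)}) x y} ≤ q →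
      (bondPercolation (zdGraph 3) p).real
        {ω : BondConfig (Site 3) | ∃ x y : Site 3,
          (∃ z : Site 3, PathIn (zdGraph 3) (quietSet R ω ∩ {x : Site 3 | ∀ i, -(n : ℤ) ≤ x i ∧ x i ≤ 2 * (n : ℤ)}) x z ∧
            ∃ i : Fin 3, (n : ℤ) ≤ |z i - x i|) ∧
          (∃ z : Site 3, PathIn (zdGraph 3) (quietSet R ω ∩ {x : Site 3 | ∀ i, -(n : ℤ) ≤ x i ∧ x i ≤ 2 * (n : ℤ)}) y z ∧
            ∃ i : Fin 3, (n : ℤ) ≤ |z i - y i|) ∧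
          ¬ PathIn (zdGraph 3) (quietSet R ω ∩ {x : Site 3 | ∀ i, -(n : ℤ) ≤ x i ∧ x i ≤ 2 * (n : ℤ)}) x y} ≤ q →
      0 < (bondPercolation (zdGraph 3) p).real (finiteClustersPercolateAt 3 0) := by
  obtain ⟨q, hq, hR⟩ := blocksPercolate_concrete stub_blockLocality stub_blockMarginals
  refine ⟨q, hq, fun p n R hn hs hg => ?_⟩
  have hcoarse := hR p n R hn hs hg
  have hX : 0 < (bondPercolation (zdGraph 3) p).real (finiteClustersPercolate (zdGraph 3)) :=
    hcoarse.trans_le (DCT16.real_mono_of_forall_subset_edgeSet (zdGraph 3) _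
      fun ω hω h => stub_blocksToVacant n R ω (by omega) hω h)
  exact real_finiteClustersPercolateAt_pos p hX

end SPPComposition

/-- **The crux from the two inputs of line `sheet-plane-product`** (registered open stubs `stub_planarNonDegeneracy` (a) and
`stub_localUniqueness` (b), verbatim, as hypotheses): at the common arm range `R = max R₀ R₁` and a common large scale `n ≥ 2R+2`, the
plane product (`stub_planeProduct`) turns planar non-degeneracy into `P_{p_c}(sheet) < q`, local uniqueness gives
`P_{p_c}(two giants) < q`, continuity moves both bounds to some `p > p_c`, the renormalisation makes the origin percolate in `X` there, and
that is the route decl `VacantSetPercolates` unfolded (Disproof §0, `Iff.rfl`).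
[cite: GrimmettHolroydKozma2014, §4 (Thm. 5: p_c < p_fin from finite-size inputs)] -/
theorem vacantSetPercolates_of_sheetPlaneProductInputs
    (hA : ∃ R₀ : ℕ, 1 ≤ R₀ ∧ ∀ R : ℕ, R₀ ≤ R → ∀ ε : ℝ, 0 < ε → ∃ N : ℕ, ∀ n : ℕ, N ≤ n →
      (bondPercolation (zdGraph 3) (criticalProbI 3)).real
        {ω : BondConfig (Site 3) | ∃ x ∈ topSide n n, ∃ y ∈ bottomSide n n,
          PathIn zdStarGraph {z : Site 2 | z ∈ rectangle n n ∧ (![z 0, 0, z 1] : Site 3) ∉ quietSet R ω} x y}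
        ^ (n / (2 * R + 2)) < ε)
    (hB : ∃ R₁ : ℕ, ∀ R : ℕ, R₁ ≤ R → ∀ ε : ℝ, 0 < ε → ∃ N : ℕ, ∀ n : ℕ, N ≤ n →
      (bondPercolation (zdGraph 3) (criticalProbI 3)).real
        {ω : BondConfig (Site 3) | ∃ x y : Site 3,
          (∃ z : Site 3, PathIn (zdGraph 3) (quietSet R ω ∩ {x : Site 3 | ∀ i, -(n : ℤ) ≤ x i ∧ x i ≤ 2 * (n : ℤ)}) x z ∧
            ∃ i : Fin 3, (n : ℤ) ≤ |z i - x i|) ∧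
          (∃ z : Site 3, PathIn (zdGraph 3) (quietSet R ω ∩ {x : Site 3 | ∀ i, -(n : ℤ) ≤ x i ∧ x i ≤ 2 * (n : ℤ)}) y z ∧
            ∃ i : Fin 3, (n : ℤ) ≤ |z i - y i|) ∧
          ¬ PathIn (zdGraph 3) (quietSet R ω ∩ {x : Site 3 | ∀ i, -(n : ℤ) ≤ x i ∧ x i ≤ 2 * (n : ℤ)}) x y} < ε) :
    Summit.CriticalPhenomena.PercolationContinuityZ3.Theses.PercBurnResprinkle.VacantSetPercolates := by
  obtain ⟨q, hq, hren⟩ := SPPComposition.renormalisation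
  obtain ⟨R₀, hR₀, hA⟩ := hA
  obtain ⟨R₁, hB⟩ := hB
  obtain ⟨Na, hNa⟩ := hA (max R₀ R₁) (le_max_left _ _) q hq
  obtain ⟨Nb, hNb⟩ := hB (max R₀ R₁) (le_max_right _ _) q hq
  set n : ℕ := max (max Na Nb) (2 * max R₀ R₁ + 2) with hn
  have hn2 : 2 * max R₀ R₁ + 2 ≤ n := le_max_right _ _
  have hna : Na ≤ n := (le_max_left _ _).trans (le_max_left _ _)
  have hnb : Nb ≤ n := (le_max_right _ _).trans (le_max_left _ _)
  have hk : n / (2 * max R₀ R₁ + 2) * (2 * max R₀ R₁ + 2) ≤ n := Nat.div_mul_le_self _ _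
  have hsheet := (stub_planeProduct (criticalProbI 3) n (max R₀ R₁) _ hk).trans_lt (hNa n hna)
  have hgiant := hNb n hnb
  obtain ⟨p, hpc, hs, hg⟩ := SPPComposition.exists_supercritical_of_lt n (max R₀ R₁) q hsheet hgiant
  exact ⟨p, hpc, hren p n (max R₀ R₁) hn2 hs hg⟩

/-! ### A sufficient one-range form of input (a) -/

/-- Armed planar `∗`-crossings are ANTITONE in the arm range: for `R₀ ≤ R`, an `R`-armed site is `R₀`-armed (first exit,
`PlanarArmedSections.armEvent_anti`, for configurations supported on `E(ℤ³)`), so `P(∗-crossing at range R) ≤ P(∗-crossing at range R₀)`.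
[folklore] -/
theorem real_armedStarCrossing_anti (p : unitInterval) (n : ℕ) {R₀ R : ℕ} (hR : R₀ ≤ R) :
    (bondPercolation (zdGraph 3) p).real
      {ω : BondConfig (Site 3) | ∃ x ∈ topSide n n, ∃ y ∈ bottomSide n n,
          PathIn zdStarGraph {z : Site 2 | z ∈ rectangle n n ∧ (![z 0, 0, z 1] : Site 3) ∉ quietSet R ω} x y} ≤
    (bondPercolation (zdGraph 3) p).real
      {ω : BondConfig (Site 3) | ∃ x ∈ topSide n n, ∃ y ∈ bottomSide n n,
          PathIn zdStarGraph {z : Site 2 | z ∈ rectangle n n ∧ (![z 0, 0, z 1] : Site 3) ∉ quietSet R₀ ω} x y} := by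
  refine DCT16.real_mono_of_forall_subset_edgeSet (zdGraph 3) p fun ω hω h => ?_
  obtain ⟨x, hx, y, hy, hpath⟩ := h
  refine ⟨x, hx, y, hy, hpath.mono fun z hz => ⟨hz.1, fun hq => hz.2 ?_⟩⟩
  rw [mem_quietSet] at hq ⊢
  exact fun harm => hq (Summit.CriticalPhenomena.PercolationContinuityZ3.Theorems.PlanarArmedSections.armEvent_anti hω hR harm)

/-- **One-range RSW-type non-degeneracy implies input (a)**: if at ONE arm range `R₀ ≥ 1` the armed `∗`-crossing probability of the
`n`-square at `p_c` stays `≤ 1 - c` for all large `n` (`c > 0`; equivalently the planar quiet nn-crossing probability `v(n,R₀) ≥ c`),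
then `P_{p_c}(∗-crossing at range R)^{⌊n/(2R+2)⌋} → 0` for every `R ≥ R₀` (antitonicity in `R` and `(1-c)^m → 0`). [folklore] -/
theorem planarNonDegeneracy_of_oneRange
    (h : ∃ R₀ : ℕ, 1 ≤ R₀ ∧ ∃ c : ℝ, 0 < c ∧ ∀ᶠ n : ℕ in atTop,
      (bondPercolation (zdGraph 3) (criticalProbI 3)).real
        {ω : BondConfig (Site 3) | ∃ x ∈ topSide n n, ∃ y ∈ bottomSide n n,
          PathIn zdStarGraph {z : Site 2 | z ∈ rectangle n n ∧ (![z 0, 0, z 1] : Site 3) ∉ quietSet R₀ ω} x y} ≤ 1 - c) :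
    ∃ R₀ : ℕ, 1 ≤ R₀ ∧ ∀ R : ℕ, R₀ ≤ R → ∀ ε : ℝ, 0 < ε → ∃ N : ℕ, ∀ n : ℕ, N ≤ n →
      (bondPercolation (zdGraph 3) (criticalProbI 3)).real
        {ω : BondConfig (Site 3) | ∃ x ∈ topSide n n, ∃ y ∈ bottomSide n n,
          PathIn zdStarGraph {z : Site 2 | z ∈ rectangle n n ∧ (![z 0, 0, z 1] : Site 3) ∉ quietSet R ω} x y}
        ^ (n / (2 * R + 2)) < ε := by
  obtain ⟨R₀, hR₀, c, hc, hev⟩ := h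
  obtain ⟨N₁, hN₁⟩ := eventually_atTop.1 hev
  refine ⟨R₀, hR₀, fun R hR ε hε => ?_⟩
  -- `0 ≤ 1 - c < 1`
  have h1c0 : 0 ≤ 1 - c := (measureReal_nonneg).trans (hN₁ N₁ le_rfl)
  have h1c1 : 1 - c < 1 := by linarith
  obtain ⟨m, hm⟩ := exists_pow_lt_of_lt_one hε h1c1
  refine ⟨max N₁ (m * (2 * R + 2)), fun n hn => ?_⟩
  have hnN : N₁ ≤ n := (le_max_left _ _).trans hn
  have hnm : m ≤ n / (2 * R + 2) := by
    have : m * (2 * R + 2) ≤ n := (le_max_right _ _).trans hn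
    exact (Nat.le_div_iff_mul_le (by omega)).2 this
  have hP := (real_armedStarCrossing_anti (criticalProbI 3) n hR).trans (hN₁ n hnN)
  calc (bondPercolation (zdGraph 3) (criticalProbI 3)).real
          {ω : BondConfig (Site 3) | ∃ x ∈ topSide n n, ∃ y ∈ bottomSide n n,
          PathIn zdStarGraph {z : Site 2 | z ∈ rectangle n n ∧ (![z 0, 0, z 1] : Site 3) ∉ quietSet R ω} x y} ^ (n / (2 * R + 2))
      ≤ (1 - c) ^ (n / (2 * R + 2)) := pow_le_pow_left₀ measureReal_nonneg hP _
    _ ≤ (1 - c) ^ m := pow_le_pow_of_le_one h1c0 h1c1.le hnm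
    _ < ε := hm

/-- **The crux from the one-range non-degeneracy and local uniqueness** (the cleanest promotable pair of inputs of this line).
[cite: GrimmettHolroydKozma2014, §4 (Thm. 5)] -/
theorem vacantSetPercolates_of_oneRange_of_localUniqueness
    (hA : ∃ R₀ : ℕ, 1 ≤ R₀ ∧ ∃ c : ℝ, 0 < c ∧ ∀ᶠ n : ℕ in atTop,
      (bondPercolation (zdGraph 3) (criticalProbI 3)).real
        {ω : BondConfig (Site 3) | ∃ x ∈ topSide n n, ∃ y ∈ bottomSide n n,
          PathIn zdStarGraph {z : Site 2 | z ∈ rectangle n n ∧ (![z 0, 0, z 1] : Site 3) ∉ quietSet R₀ ω} x y} ≤ 1 - c)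
    (hB : ∃ R₁ : ℕ, ∀ R : ℕ, R₁ ≤ R → ∀ ε : ℝ, 0 < ε → ∃ N : ℕ, ∀ n : ℕ, N ≤ n →
      (bondPercolation (zdGraph 3) (criticalProbI 3)).real
        {ω : BondConfig (Site 3) | ∃ x y : Site 3,
          (∃ z : Site 3, PathIn (zdGraph 3) (quietSet R ω ∩ {x : Site 3 | ∀ i, -(n : ℤ) ≤ x i ∧ x i ≤ 2 * (n : ℤ)}) x z ∧
            ∃ i : Fin 3, (n : ℤ) ≤ |z i - x i|) ∧
          (∃ z : Site 3, PathIn (zdGraph 3) (quietSet R ω ∩ {x : Site 3 | ∀ i, -(n : ℤ) ≤ x i ∧ x i ≤ 2 * (n : ℤ)}) y z ∧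
            ∃ i : Fin 3, (n : ℤ) ≤ |z i - y i|) ∧
          ¬ PathIn (zdGraph 3) (quietSet R ω ∩ {x : Site 3 | ∀ i, -(n : ℤ) ≤ x i ∧ x i ≤ 2 * (n : ℤ)}) x y} < ε) :
    Summit.CriticalPhenomena.PercolationContinuityZ3.Theses.PercBurnResprinkle.VacantSetPercolates :=
  vacantSetPercolates_of_sheetPlaneProductInputs (planarNonDegeneracy_of_oneRange hA) hB

/-- **Registered transfer stub of the line** (`stub_sheetPlaneProductTransfer`, registered on stmt-CriticalPhenomena-7205): the two open
inputs (a) `stub_planarNonDegeneracy` and (b) `stub_localUniqueness` (verbatim) imply the crux decl by name —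
`vacantSetPercolates_of_sheetPlaneProductInputs` restated in the registry's arrow form. [cite: GrimmettHolroydKozma2014, §4 (Thm. 5)] -/
theorem stub_sheetPlaneProductTransfer :
    (∃ R₀ : ℕ, 1 ≤ R₀ ∧ ∀ R : ℕ, R₀ ≤ R → ∀ ε : ℝ, 0 < ε → ∃ N : ℕ, ∀ n : ℕ, N ≤ n → (bondPercolation (zdGraph 3) (criticalProbI 3)).real {ω : BondConfig (Site 3) | ∃ x ∈ topSide n n, ∃ y ∈ bottomSide n n, PathIn zdStarGraph {z : Site 2 | z ∈ rectangle n n ∧ (![z 0, 0, z 1] : Site 3) ∉ quietSet R ω} x y} ^ (n / (2 * R + 2)) < ε) →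
    (∃ R₁ : ℕ, ∀ R : ℕ, R₁ ≤ R → ∀ ε : ℝ, 0 < ε → ∃ N : ℕ, ∀ n : ℕ, N ≤ n → (bondPercolation (zdGraph 3) (criticalProbI 3)).real {ω : BondConfig (Site 3) | ∃ x y : Site 3, (∃ z : Site 3, PathIn (zdGraph 3) (quietSet R ω ∩ {x : Site 3 | ∀ i, -(n : ℤ) ≤ x i ∧ x i ≤ 2 * (n : ℤ)}) x z ∧ ∃ i : Fin 3, (n : ℤ) ≤ |z i - x i|) ∧ (∃ z : Site 3, PathIn (zdGraph 3) (quietSet R ω ∩ {x : Site 3 | ∀ i, -(n : ℤ) ≤ x i ∧ x i ≤ 2 * (n : ℤ)}) y z ∧ ∃ i : Fin 3, (n : ℤ) ≤ |z i - y i|) ∧ ¬ PathIn (zdGraph 3) (quietSet R ω ∩ {x : Site 3 | ∀ i, -(n : ℤ) ≤ x i ∧ x i ≤ 2 * (n : ℤ)}) x y} < ε) →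
    Summit.CriticalPhenomena.PercolationContinuityZ3.Theses.PercBurnResprinkle.VacantSetPercolates :=
  fun hA hB => vacantSetPercolates_of_sheetPlaneProductInputs hA hB

end Summit.CriticalPhenomena.PercolationContinuityZ3.Theorems

end
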